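import Summits.Langlands.Langlands.Theorems.IrreducibilityBySelfDualityGaloisRepOfRegularAlgebraicGL2CMSuffices
import Literature.NumberTheory.Automorphic.BaseChangeStrongCuspidalPrime
import HarnessLib

/-!
# The `GL₂/CM/a.e.` form of `GaloisRepOfRegularAlgebraic` (stmt-Langlands-10785) from three named leaves

Helper file (`--supports stmt-Langlands-10785`) of the crux line `Cruxes/GaloisRepOfRegularAlgebraic/Lines/Sketch.lean`
(lead c6, 2026-08-16).  The consumption audit of lead c5 (`Cruxes/GaloisRepOfRegularAlgebraic/CONSUMPTION-AUDIT-c5.md`,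
kernel-checked in `…GaloisRepOfRegularAlgebraicGL2CMSuffices.lean`) shows that route
`IrreducibilityBySelfDuality` consumes the crux (lang.S27 verbatim: every `n`, `K` totally real or CM,
every unramified `v ∤ ℓ`, `r` semisimple) only in the weaker shape

  `GL₂/CM/a.e.`: for `K` CM, `σ` regular algebraic cuspidal on `GL₂(𝔸_K)`, `ℓ`, `ι`, SOME continuous
  `ρ : Γ_K → GL₂(ℚ̄_ℓ)` unramified with `char(ρ(Frob_v)) = arithFrobPolyOfSatake ι q_v 2 β` for the
  Satake parameter `β` of `σ` at all but finitely many `v`.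

This file records, kernel-checked, the exact trust base of THAT statement in the tree: the three named
automorphic leaves of Harris–Lan–Taylor–Thorne's Theorem A (existence) —

* `HarrisLanTaylorThorne2016.corollary627_splitOrUnramified` (HLTT 2016 Cor. 6.27; = route item
  stmt-Langlands-15020 `HLTTCor627SplitOrUnramified`, verbatim),
* `ArthurClozel1989_strongLifting_archimedean` (Arthur–Clozel Ch. 3 Thm. 5.1, archimedean clause; = route
  item stmt-Langlands-15021 `ACStrongLiftingArchimedean`, verbatim),
* `ArthurClozel1989_strongLifting_cuspidal` (Arthur–Clozel Ch. 3 Thm. 4.2 (a)/5.1, strong cuspidal base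
  change in prime degree; = route item stmt-Langlands-15022 `ACStrongCuspidalBaseChangePrime`, verbatim
  with `IsUnramifiedBaseChangeLift` unfolded) —

and NOT Varma 2024 (`Varma2024.prop71_twoN` / `theorem1_unramified_traces`, route item stmt-Langlands-15004,
the line's stub S2), which the crux AS FILED additionally needs (`of_namedLeaves`, four leaves).  So a
planner restating the crux as `GL₂/CM/a.e.` can split it over the EXISTING children 15020/15021/15022
with this theorem as glue (`gl2CM_ae_of_namedLeaves`), dropping child 15004 from the cone.

References: Harris–Lan–Taylor–Thorne, Res. Math. Sci. 3:37 (2016), Thm. A, Cor. 6.27, Cor. 7.14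
[HarrisLanTaylorThorneRMS2016]; J. Arthur, L. Clozel, Ann. of Math. Stud. 120 (1989), Ch. 3 Thms. 4.2, 5.1
[ArthurClozelAMS120].
-/

noncomputable section

set_option linter.dupNamespace false -- project-wide option; `Summit.Langlands.Langlands` is the mandated namespace (D-0017)

open scoped NumberField
open IsDedekindDomain Field
open Literature.NumberTheory.Automorphic Literature.NumberTheory.GaloisRepresentations
open Literature.NumberTheory.Automorphic.HarrisLanTaylorThorne2016

namespace Summit.Langlands.Langlands.Theorems.GaloisRepOfRegularAlgebraic

/-- **The `GL₂/CM/a.e.` form of the crux from the three named leaves of HLTT's Theorem A (existence)**: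
HLTT Cor. 6.27 (`corollary627_splitOrUnramified`), Arthur–Clozel's archimedean clause
(`ArthurClozel1989_strongLifting_archimedean`) and strong cuspidal prime-degree base change
(`ArthurClozel1989_strongLifting_cuspidal`) imply: for `K` CM and `σ` regular algebraic cuspidal on
`GL₂(𝔸_K)`, for every `ℓ`, `ι` there is a continuous `ρ : Γ_K → GL₂(ℚ̄_ℓ)` unramified and
Satake–Frobenius compatible with `σ` at all but finitely many places.  Proof: Thm. A (existence) from the
three leaves by the Literature theorem `theoremA_existence_of_leaves'` (Sorensen patching over the family
`K(√-D)`, the rank-one case by Weil 1956 — all proved in the tree), then `gl2CM_ae_of_theoremA_existence`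
(Thm. A at `n = 2`, read almost everywhere).  Varma's theorem is not used.
[cite: HarrisLanTaylorThorneRMS2016, Thm. A (p. 3), Cor. 6.27, Cor. 7.14 (p. 232)]
[cite: ArthurClozelAMS120, Ch. 3 Thm. 4.2 (a), Thm. 5.1] -/
theorem gl2CM_ae_of_namedLeaves :
    corollary627_splitOrUnramified → ArthurClozel1989_strongLifting_archimedean →
      ArthurClozel1989_strongLifting_cuspidal →
    ∀ (K : Type) [Field K] [NumberField K]
      (hcpt₂ : Literature.NumberTheory.Automorphic.isCompact_glFiniteIntegralLevel 2 K),
      NumberField.IsCMField K →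
      ∀ (σ : Literature.NumberTheory.Automorphic.CuspidalAutomorphicRepData 2 K hcpt₂),
      σ.1.IsRegularAlgebraic → ∀ (ℓ : ℕ) [Fact ℓ.Prime] (ι : PadicAlgCl ℓ ≃+* ℂ),
      ∃ ρ : Literature.NumberTheory.GaloisRepresentations.FramedGaloisRep K (PadicAlgCl ℓ) 2,
        ∀ᶠ v : IsDedekindDomain.HeightOneSpectrum (NumberField.RingOfIntegers K) in Filter.cofinite,
          ∀ β : Multiset ℂ, σ.1.HasSatakeParamAt v β →
            ρ.IsUnramifiedAt v ∧ ρ.HasFrobCharpolyAt v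
              (Literature.NumberTheory.Automorphic.arithFrobPolyOfSatake ι v.residueCard 2 β) :=
  fun h627 harch hBC => gl2CM_ae_of_theoremA_existence (theoremA_existence_of_leaves' h627 harch hBC)

end Summit.Langlands.Langlands.Theorems.GaloisRepOfRegularAlgebraic

end
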